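import Summits.Ventures.CertifiedManyBodySolver.Observables.PairLROTowerChargedStep
import Literature.MathematicalPhysics.QuantumLattice.TranslationSumDoubleCommutator
import Literature.MathematicalPhysics.QuantumLattice.HubbardNNNHoppingGrandCanonicalFloor
import HarnessLib

/-!
# OP1-C, part 2: the one-point / tower ceiling with CHARGED equation-of-motion rows at a supporting slope is sound

HONEST FRAMING: first certified bounds on pairing observables; not a superconductivity verdict; a ceiling route,
never presence. Crew hubbard-obs (D-0042), seat hubbard-obs-p1 (`prover-hubbard-obs-p1-g8-0`), typing the
soundness claim of sr-mbsolver-menu-3 (MENU3-TLPINCER.md §7.4–7.8). Zero compute; no definition; no `sorry`.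

`liminf_pairFieldLRO_le_sq_of_onePoint_stationary_bound_TT'` (tier OP1-S) lets the one-point bound carry the
slack `Re⟨ζ,[H_L, W_L]ζ⟩/L²` of the translation sum of a NEUTRAL local word. Here the word `w` is ARBITRARY (even,
with even adjoint — e.g. a pair word), the slack is the CHARGED row `Re⟨ζ,[K_L, W_L]ζ⟩/L²`, `K_L = H_L − μ_c N̂`,
at a chemical potential `μ_c ∈ [μ₋(n), μ₊(n)]` (the subdifferential of the convex energy density at the density
`n` of the family), and the conclusion `liminf_k u_k ≤ (c − A + (Σμ_σ)(n/2 − ν))²` is UNCHANGED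
(`liminf_pairFieldLRO_le_sq_of_onePoint_chargedStationary_bound_TT'`). Mechanism: the grand-canonical floor at a
supporting slope (HubbardNNNHoppingGrandCanonicalFloor; Fenchel–Young inside) makes the tower witness's `K`-excess
`ε_L = o(L²)`, and `tower_finite_step_C` (Pusz–Woronowicz on the whole Fock space) bounds the charged slack by
`√(2(ε_L/L²)D₁′) + √(2(ε_L/L²)D₂′) → 0`; the `H_L`-part of the double-commutator constants is
TranslationSumDoubleCommutator, the `N̂`-part is the input `hDDN₁/₂` (for a charge-`q` word: `(q/2)[W,W†]`, `O(L²)`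
by TranslationSumCommutatorLocality). No sector-convexity licence; charged POSITIVITY blocks are not covered.

References: T. Koma, H. Tasaki, J. Stat. Phys. 76 (1994) 745, Theorem 5 [KomaTasaki1994]; W. Pusz, S. L.
Woronowicz, Comm. Math. Phys. 58 (1978) 273, §1 [PuszWoronowicz1978]; X. Han, arXiv:2006.06002, §2–3
[Han2020Bootstrap]; M. Araújo et al., arXiv:2311.18707 [AraujoEtAl2023]; D. Ruelle, *Statistical Mechanics*
(1969) §3.4 [Ruelle1969].
-/

noncomputable section

namespace Summit.Ventures.CertifiedManyBodySolver.Observables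

open Matrix Complex Finset Literature.MathematicalPhysics.QuantumLattice Literature.Probability.LatticeModels
open Literature.MathematicalPhysics.QuantumLattice.HubbardWave0 ThermodynamicLimit Filter Topology
open Literature.MathematicalPhysics.QuantumManyBody.StateRelaxation
open scoped ComplexOrder ComplexConjugate BigOperators


/-! ### Families of sector ground states: (OP1-C) ⇒ `liminf u_k ≤ M²` -/

section Family

variable (g : Site 2 → ℝ)

/-- **OP1-C is sound at a supporting slope: a one-point bound valid up to a CHARGED equation-of-motion slack
still gives `liminf_k u_k ≤ M²`.** Let `U ≥ 0`, `0 < n < 2`, `κ ≥ 0`, `e(t,t',U,n) ≤ u`,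
`μ_c ∈ [μ₋(n), μ₊(n)]` (the subdifferential of `e` at `n`), and let `w ∈ 𝔄_{Λ_w}` be any local word with
`w`, `wᴴ` even (e.g. a `d`-wave pair word — the CHARGED equation-of-motion rows `ω([H − μ_c N̂, X]) = 0` of the
bootstrap with their multipliers). Suppose the double commutators of the Hermitian parts `B₁, B₂` of
`W_L = Σ_v T_v Γ_L(w)` with the particle number are `O(L²)` (`hDDN₁/₂`), and (OP1-C): for every side
`L ≥ L₁` and every unit vector `ζ` of the torus,
`c − A + Σ_σ μ_σ(Re⟨ζ,N_σζ⟩/L² − ν) + κ(u − Re⟨ζ,H_Lζ⟩/L²) + Re⟨ζ, (K_L W_L − W_L K_L) ζ⟩/L² ≤ −Re⟨ζ,Δ_gζ⟩/L²`,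
`K_L = H_L − μ_c N̂`, `H_L = hubbardTorusTT' L t t' U`. Then every family of unit `(rectN n L, S^z=0)`-sector
ground states has `liminf_k u_k ≤ (c − A + (Σ_σ μ_σ)(n/2 − ν))²` — the conclusion of
`liminf_pairFieldLRO_le_sq_of_onePoint_variational_bound_TT'`. No sector-convexity / equivalence-of-ensembles
licence is used. [cite: KomaTasaki1994, Theorem 5] [cite: PuszWoronowicz1978, §1] [cite: Han2020Bootstrap, §2–3]
[cite: Ruelle1969, §3.4] -/
theorem liminf_pairFieldLRO_le_sq_of_onePoint_chargedStationary_bound_TT' (t t' : ℝ) {U n : ℝ} (hU : 0 ≤ U)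
    (hn0 : 0 < n) (hn2 : n < 2) {c A κ u ν : ℝ} (μ : Fin 2 → ℝ) (hκ : 0 ≤ κ)
    (hu : energyDensityTT' t t' U n ≤ u) {μc : ℝ}
    (hμc : μc ∈ Set.Icc (chemPotMinusTT' t t' U n) (chemPotPlusTT' t t' U n))
    {Λw : Finset (Site 2)} (wloc : FermionOp Λw)
    (hweven : wloc ∈ carEvenSubalgebra (Finset.univ : Finset (Orb (PolySite Λw))))
    (hwevenH : wlocᴴ ∈ carEvenSubalgebra (Finset.univ : Finset (Orb (PolySite Λw)))) (L₁ : ℕ)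
    (hInjw : ∀ L : ℕ, L₁ ≤ L → Set.InjOn (Torus.proj (d := 2) L) ↑Λw)
    {DN : ℝ} (LN : ℕ) (hDN : 0 ≤ DN)
    (hDDN₁ : ∀ (L : ℕ) [NeZero L] (hL : L₁ ≤ L), LN ≤ L → ∀ χ : Fock (Orb (FermionTorus 2 L)), star χ ⬝ᵥ χ = 1 →
      |(star χ ⬝ᵥ (((∑ v : TorusSite 2 L, relabel (Orb.translate v)
          (fermionEmbed (PolySite.toTorusEmb L (hInjw L hL)) (((1 / 2 : ℂ)) • (wloc + wlocᴴ)))) *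
        ((∑ v : TorusSite 2 L, relabel (Orb.translate v)
          (fermionEmbed (PolySite.toTorusEmb L (hInjw L hL)) (((1 / 2 : ℂ)) • (wloc + wlocᴴ)))) * totalNumber -
          totalNumber * (∑ v : TorusSite 2 L, relabel (Orb.translate v)
          (fermionEmbed (PolySite.toTorusEmb L (hInjw L hL)) (((1 / 2 : ℂ)) • (wloc + wlocᴴ))))) -
        ((∑ v : TorusSite 2 L, relabel (Orb.translate v)
          (fermionEmbed (PolySite.toTorusEmb L (hInjw L hL)) (((1 / 2 : ℂ)) • (wloc + wlocᴴ)))) * totalNumber -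
          totalNumber * (∑ v : TorusSite 2 L, relabel (Orb.translate v)
          (fermionEmbed (PolySite.toTorusEmb L (hInjw L hL)) (((1 / 2 : ℂ)) • (wloc + wlocᴴ))))) *
        (∑ v : TorusSite 2 L, relabel (Orb.translate v)
          (fermionEmbed (PolySite.toTorusEmb L (hInjw L hL)) (((1 / 2 : ℂ)) • (wloc + wlocᴴ))))) *ᵥ χ)).re| ≤
        DN * (L : ℝ) ^ 2)
    (hDDN₂ : ∀ (L : ℕ) [NeZero L] (hL : L₁ ≤ L), LN ≤ L → ∀ χ : Fock (Orb (FermionTorus 2 L)), star χ ⬝ᵥ χ = 1 →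
      |(star χ ⬝ᵥ (((∑ v : TorusSite 2 L, relabel (Orb.translate v)
          (fermionEmbed (PolySite.toTorusEmb L (hInjw L hL)) ((I / 2 : ℂ) • (wlocᴴ - wloc)))) *
        ((∑ v : TorusSite 2 L, relabel (Orb.translate v)
          (fermionEmbed (PolySite.toTorusEmb L (hInjw L hL)) ((I / 2 : ℂ) • (wlocᴴ - wloc)))) * totalNumber -
          totalNumber * (∑ v : TorusSite 2 L, relabel (Orb.translate v)
          (fermionEmbed (PolySite.toTorusEmb L (hInjw L hL)) ((I / 2 : ℂ) • (wlocᴴ - wloc))))) -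
        ((∑ v : TorusSite 2 L, relabel (Orb.translate v)
          (fermionEmbed (PolySite.toTorusEmb L (hInjw L hL)) ((I / 2 : ℂ) • (wlocᴴ - wloc)))) * totalNumber -
          totalNumber * (∑ v : TorusSite 2 L, relabel (Orb.translate v)
          (fermionEmbed (PolySite.toTorusEmb L (hInjw L hL)) ((I / 2 : ℂ) • (wlocᴴ - wloc))))) *
        (∑ v : TorusSite 2 L, relabel (Orb.translate v)
          (fermionEmbed (PolySite.toTorusEmb L (hInjw L hL)) ((I / 2 : ℂ) • (wlocᴴ - wloc))))) *ᵥ χ)).re| ≤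
        DN * (L : ℝ) ^ 2)
    (hboundC : ∀ (L : ℕ) [NeZero L] (hL : L₁ ≤ L) (ζ : Fock (Orb (FermionTorus 2 L))), star ζ ⬝ᵥ ζ = 1 →
      c - A + ∑ σ : Fin 2, μ σ *
          ((star ζ ⬝ᵥ ((∑ y : FermionTorus 2 L, numberOp y σ) *ᵥ ζ)).re / (L : ℝ) ^ 2 - ν) +
        κ * (u - (star ζ ⬝ᵥ (hubbardTorusTT' L t t' U *ᵥ ζ)).re / (L : ℝ) ^ 2) +
        (star ζ ⬝ᵥ (((hubbardTorusTT' L t t' U - (μc : ℂ) • totalNumber) *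
              (∑ v : TorusSite 2 L, relabel (Orb.translate v)
                (fermionEmbed (PolySite.toTorusEmb L (hInjw L hL)) wloc)) -
            (∑ v : TorusSite 2 L, relabel (Orb.translate v)
                (fermionEmbed (PolySite.toTorusEmb L (hInjw L hL)) wloc)) *
              (hubbardTorusTT' L t t' U - (μc : ℂ) • totalNumber)) *ᵥ ζ)).re / (L : ℝ) ^ 2 ≤
        -((expect (pairField g L) ζ).re / (L : ℝ) ^ 2))
    (ψ : ∀ L, Fock (Orb (FermionTorus 2 L)))
    (hψ : ∀ L, IsGroundStateInSector (hubbardTorusTT' L t t' U) (rectN n L) 0 (ψ L))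
    (hψ1 : ∀ L, star (ψ L) ⬝ᵥ ψ L = 1) :
    liminf (fun k : ℕ => (∑ x ∈ halfOpenBox 2 (2 * k), ∑ y ∈ halfOpenBox 2 (2 * k),
        torusPullback (pairFieldCorr g ψ) (2 * k) x y) / ((#(halfOpenBox 2 (2 * k)) : ℝ)) ^ 2) atTop ≤
      (c - A + (∑ σ : Fin 2, μ σ) * (n / 2 - ν)) ^ 2 := by
  obtain ⟨Cγ, Lγ, hCγ, hγ⟩ := exists_abs_re_expect_commutator_pairField_le g
  obtain ⟨Cα, Lα, hCα, hα⟩ := exists_eucNorm_pairField_conjTranspose_mulVec_le g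
  obtain ⟨Cκ, Lκ, hCκ, hκ'⟩ := exists_eucNorm_commutator_hubbardTorusTT'_pairField_conjTranspose_mulVec_le g t t' U
  set O₁ : FermionOp Λw := (1 / 2 : ℂ) • (wloc + wlocᴴ) with hO₁
  set O₂ : FermionOp Λw := (I / 2 : ℂ) • (wlocᴴ - wloc) with hO₂
  have hO₁even : O₁ ∈ carEvenSubalgebra (Finset.univ : Finset (Orb (PolySite Λw))) :=
    Subalgebra.smul_mem _ (Subalgebra.add_mem _ hweven hwevenH) _
  have hO₂even : O₂ ∈ carEvenSubalgebra (Finset.univ : Finset (Orb (PolySite Λw))) :=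
    Subalgebra.smul_mem _ (Subalgebra.sub_mem _ hwevenH hweven) _
  obtain ⟨D₁, LD₁, hD₁, hDD₁⟩ := exists_norm_expect_doubleCommutator_sum_translate_le_TT' hO₁even t t' U
  obtain ⟨D₂, LD₂, hD₂, hDD₂⟩ := exists_norm_expect_doubleCommutator_sum_translate_le_TT' hO₂even t t' U
  set D₁' : ℝ := D₁ + |μc| * DN with hD₁'
  set D₂' : ℝ := D₂ + |μc| * DN with hD₂'
  have hD₁' : 0 ≤ D₁' := by positivity
  have hD₂' : 0 ≤ D₂' := by positivity
  set M : ℝ := -(c - A + (∑ σ : Fin 2, μ σ) * (n / 2 - ν)) with hM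
  have hM2 : (c - A + (∑ σ : Fin 2, μ σ) * (n / 2 - ν)) ^ 2 = M ^ 2 := by rw [hM, neg_sq]
  rw [hM2]
  set useq : ℕ → ℝ := fun k => (∑ x ∈ halfOpenBox 2 (2 * k), ∑ y ∈ halfOpenBox 2 (2 * k),
      torusPullback (pairFieldCorr g ψ) (2 * k) x y) / ((#(halfOpenBox 2 (2 * k)) : ℝ)) ^ 2 with huseq
  change liminf useq atTop ≤ M ^ 2
  set vseq : ℕ → ℝ := fun m =>
    (expect ((pairField g (m + 1))ᴴ * pairField g (m + 1)) (ψ (m + 1))).re / (((m + 1 : ℕ) : ℝ)) ^ 4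
    with hvseq
  have hterm : ∀ k : ℕ, 1 ≤ k → ∃ m : ℕ, 2 * k = m + 1 ∧ useq k = vseq m := by
    intro k hk
    obtain ⟨m, hm⟩ : ∃ m, 2 * k = m + 1 := ⟨2 * k - 1, by omega⟩
    refine ⟨m, hm, ?_⟩
    simp only [huseq, hvseq]
    rw [hm, torusLROSeq_pairFieldCorr_succ]
  have hvnonneg : ∀ m : ℕ, 0 ≤ vseq m := fun m => by
    simp only [hvseq]
    refine div_nonneg ?_ (by positivity)
    exact (Complex.nonneg_iff.1
      ((Matrix.posSemidef_conjTranspose_mul_self (pairField g (m + 1))).dotProduct_mulVec_nonneg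
        (ψ (m + 1)))).1
  have hnonneg : ∀ k : ℕ, 1 ≤ k → 0 ≤ useq k := fun k hk => by
    obtain ⟨m, -, heq⟩ := hterm k hk
    rw [heq]
    exact hvnonneg m
  have hbdd : IsBoundedUnder (· ≥ ·) atTop useq :=
    isBoundedUnder_of_eventually_ge (a := 0) (Filter.eventually_atTop.2 ⟨1, fun k hk => hnonneg k hk⟩)
  by_contra hcon
  rw [not_le] at hcon
  obtain ⟨c₀, hc₀M, hc₀lim⟩ := exists_between hcon
  have hc₀ : 0 < c₀ := lt_of_le_of_lt (sq_nonneg M) hc₀M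
  have hev : ∀ᶠ k : ℕ in atTop, c₀ < useq k := eventually_lt_of_lt_liminf hc₀lim hbdd
  have hsqrt_pos : 0 < Real.sqrt c₀ := Real.sqrt_pos.2 hc₀
  have hMlt : M < Real.sqrt c₀ := by
    have h1 : |M| < Real.sqrt c₀ := by
      rw [← Real.sqrt_sq_eq_abs]; exact Real.sqrt_lt_sqrt (sq_nonneg M) hc₀M
    exact lt_of_le_of_lt (le_abs_self M) h1
  obtain ⟨kt, hkt⟩ : ∃ kt : ℕ, M < (kt : ℝ) / (kt + 1) * Real.sqrt c₀ := by
    set δ : ℝ := 1 - M / Real.sqrt c₀ with hδ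
    have hδpos : 0 < δ := by
      rw [hδ, sub_pos, div_lt_one hsqrt_pos]; exact hMlt
    obtain ⟨kt, hkt⟩ := exists_nat_gt (1 / δ)
    refine ⟨kt, ?_⟩
    have hk1 : (0 : ℝ) < kt + 1 := by positivity
    have h1 : 1 / ((kt : ℝ) + 1) < δ := by
      rw [div_lt_iff₀ hk1]
      have : 1 / δ * δ = 1 := by field_simp
      nlinarith [hkt, hδpos]
    have h2 : (kt : ℝ) / (kt + 1) = 1 - 1 / (kt + 1) := by field_simp; ring
    rw [h2]
    have h3 : M / Real.sqrt c₀ < 1 - 1 / ((kt : ℝ) + 1) := by rw [hδ] at h1; linarith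
    have := (div_lt_iff₀ hsqrt_pos).1 h3
    linarith
  set Dbar : ℝ := (Cκ / Real.sqrt (c₀ / 2)) * ∑ i ∈ Finset.range kt, (Cα / Real.sqrt (c₀ / 2)) ^ i with hDbar
  set K : ℝ := -(∑ σ : Fin 2, μ σ) * kt / 2 + κ * Dbar with hK
  set cc : ℝ := 16 * |t| + 32 * |t'| with hcc
  set C₀ : ℝ := 4 * (18 * (2 * |t| + |U| + 2 * |t'|)) + 2 * |μc| with hC₀
  obtain ⟨L₂, hL₂⟩ : ∃ L₂ : ℕ, ∀ L : ℕ, L₂ ≤ L → ((kt : ℝ) + 1) * Cγ ≤ (c₀ / 2) * (L : ℝ) ^ 2 := by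
    obtain ⟨L₂, hL₂⟩ := exists_nat_ge (((kt : ℝ) + 1) * Cγ / (c₀ / 2))
    refine ⟨max L₂ 1, fun L hL => ?_⟩
    have hL1 : (1 : ℝ) ≤ L := by exact_mod_cast le_trans (le_max_right _ _) hL
    have hLL : (L₂ : ℝ) ≤ L := by exact_mod_cast le_trans (le_max_left _ _) hL
    have hc2 : 0 < c₀ / 2 := by linarith
    have h1 : ((kt : ℝ) + 1) * Cγ ≤ (c₀ / 2) * L := by
      rw [div_le_iff₀ hc2] at hL₂
      calc ((kt : ℝ) + 1) * Cγ ≤ (L₂ : ℝ) * (c₀ / 2) := hL₂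
        _ ≤ (L : ℝ) * (c₀ / 2) := mul_le_mul_of_nonneg_right hLL hc2.le
        _ = (c₀ / 2) * L := mul_comm _ _
    have h2 : (c₀ / 2) * (L : ℝ) ≤ (c₀ / 2) * (L : ℝ) ^ 2 := by
      have : (L : ℝ) ≤ (L : ℝ) ^ 2 := le_self_pow₀ hL1 two_ne_zero
      exact mul_le_mul_of_nonneg_left this hc2.le
    linarith
  set Lr : ℕ → ℝ := fun k => ((2 * k : ℕ) : ℝ) with hLr
  set Eseq : ℕ → ℝ := fun k =>
    groundEnergy (hubbardTorusTT' (2 * k) t t' U) (rectN n (2 * k)) / ((2 * k : ℕ) : ℝ) ^ 2 with hEseq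
  set Nseq : ℕ → ℝ := fun k => (rectN n (2 * k) : ℝ) / ((2 * k : ℕ) : ℝ) ^ 2 with hNseq
  set εseq : ℕ → ℝ := fun k =>
    max (groundEnergy (hubbardTorusTT' (2 * k) t t' U) (rectN n (2 * k)) + Dbar -
        μc * ((rectN n (2 * k) : ℝ) + kt) -
      ((energyDensityTT' t t' U n - μc * n) * ((2 * k : ℕ) : ℝ) ^ 2 - cc * ((2 * k : ℕ) : ℝ) - C₀)) 0
    with hεseq
  set dseq : ℕ → ℝ := fun k =>
    Eseq k + Dbar / Lr k ^ 2 - μc * (Nseq k + kt / Lr k ^ 2) -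
      (energyDensityTT' t t' U n - μc * n) + cc / Lr k + C₀ / Lr k ^ 2 with hdseq
  set Slseq : ℕ → ℝ := fun k =>
    (Real.sqrt (2 * εseq k * D₁') + Real.sqrt (2 * εseq k * D₂')) / Lr k with hSlseq
  set lhs : ℕ → ℝ := fun k => (kt : ℝ) / (kt + 1) * Real.sqrt (c₀ - (kt + 1) * Cγ / Lr k ^ 2) with hlhs
  set rhs : ℕ → ℝ := fun k =>
    -(c - A + (∑ σ : Fin 2, μ σ) * (Nseq k / 2 - ν) + κ * (u - Eseq k)) + K / Lr k ^ 2 + Slseq k with hrhs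
  have hstep : ∀ᶠ k : ℕ in atTop, lhs k ≤ rhs k := by
    filter_upwards [hev, Filter.eventually_ge_atTop
      (max 1 (max L₁ (max Lγ (max Lα (max Lκ (max L₂ (max LN (max LD₁ LD₂))))))))] with k hk hkL
    have hk1 : 1 ≤ k := le_trans (le_max_left _ _) hkL
    obtain ⟨m, hm, heq⟩ := hterm k hk1
    simp only [max_le_iff] at hkL
    obtain ⟨-, hkL₁, hkγ, hkα, hkκ, hk₂, hkN, hkD₁, hkD₂⟩ := hkL
    have hmL₁ : L₁ ≤ m + 1 := by omega
    have hmγ : Lγ ≤ m + 1 := by omega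
    have hmα : Lα ≤ m + 1 := by omega
    have hmκ : Lκ ≤ m + 1 := by omega
    have hm₂ : L₂ ≤ m + 1 := by omega
    have hmN : LN ≤ m + 1 := by omega
    have hmD₁ : LD₁ ≤ m + 1 := by omega
    have hmD₂ : LD₂ ≤ m + 1 := by omega
    set L' : ℕ := m + 1 with hL'
    have hL'1 : 1 ≤ L' := by omega
    set H := hubbardTorusTT' L' t t' U with hH
    set N : ℕ := rectN n L' with hNdef
    set Nt : Matrix (Finset (Orb (FermionTorus 2 L'))) (Finset (Orb (FermionTorus 2 L'))) ℂ := totalNumber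
      with hNt
    have hL'pos : (0 : ℝ) < (L' : ℝ) := by positivity
    have hL'2 : (0 : ℝ) < (L' : ℝ) ^ 2 := by positivity
    have hlro : c₀ * (((L' : ℕ) : ℝ)) ^ 4 ≤ (expect ((pairField g L')ᴴ * pairField g L') (ψ L')).re := by
      have h := hk.le
      rw [heq] at h
      simp only [hvseq] at h
      rwa [le_div_iff₀ (by positivity)] at h
    obtain ⟨hB₁h, hB₂h, hWB⟩ := eom_translationSum_decomposition_charged (hInjw L' hmL₁) wloc
    set B₁ := ∑ v : TorusSite 2 L', relabel (Orb.translate v)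
        (fermionEmbed (PolySite.toTorusEmb L' (hInjw L' hmL₁)) (((1 / 2 : ℂ)) • (wloc + wlocᴴ))) with hB₁def
    set B₂ := ∑ v : TorusSite 2 L', relabel (Orb.translate v)
        (fermionEmbed (PolySite.toTorusEmb L' (hInjw L' hmL₁)) ((I / 2 : ℂ) • (wlocᴴ - wloc))) with hB₂def
    have hflip : ∀ (B : Matrix (Finset (Orb (FermionTorus 2 L'))) (Finset (Orb (FermionTorus 2 L'))) ℂ) {D : ℝ},
        (∀ χ : Fock (Orb (FermionTorus 2 L')), star χ ⬝ᵥ χ = 1 →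
          ‖expect (B * (H * B - B * H) - (H * B - B * H) * B) χ‖ ≤ D * (L' : ℝ) ^ 2) →
        ∀ χ : Fock (Orb (FermionTorus 2 L')), star χ ⬝ᵥ χ = 1 →
          |(star χ ⬝ᵥ ((B * (B * H - H * B) - (B * H - H * B) * B) *ᵥ χ)).re| ≤ D * (L' : ℝ) ^ 2 := by
      intro B D hB χ hχ
      have e : B * (B * H - H * B) - (B * H - H * B) * B = -(B * (H * B - B * H) - (H * B - B * H) * B) := by
        simp only [Matrix.mul_sub, Matrix.sub_mul, neg_sub]
        abel
      rw [e, neg_mulVec, dotProduct_neg, Complex.neg_re, abs_neg]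
      exact (Complex.abs_re_le_norm _).trans (hB χ hχ)
    have hDD₁H := hflip _ (hDD₁ L' hmD₁ (hInjw L' hmL₁))
    have hDD₂H := hflip _ (hDD₂ L' hmD₂ (hInjw L' hmL₁))
    have hDDK : ∀ (B : Matrix (Finset (Orb (FermionTorus 2 L'))) (Finset (Orb (FermionTorus 2 L'))) ℂ) {D : ℝ},
        (∀ χ : Fock (Orb (FermionTorus 2 L')), star χ ⬝ᵥ χ = 1 →
          |(star χ ⬝ᵥ ((B * (B * H - H * B) - (B * H - H * B) * B) *ᵥ χ)).re| ≤ D * (L' : ℝ) ^ 2) →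
        (∀ χ : Fock (Orb (FermionTorus 2 L')), star χ ⬝ᵥ χ = 1 →
          |(star χ ⬝ᵥ ((B * (B * Nt - Nt * B) - (B * Nt - Nt * B) * B) *ᵥ χ)).re| ≤ DN * (L' : ℝ) ^ 2) →
        ∀ χ : Fock (Orb (FermionTorus 2 L')), star χ ⬝ᵥ χ = 1 →
          |(star χ ⬝ᵥ ((B * (B * (H - (μc : ℂ) • Nt) - (H - (μc : ℂ) • Nt) * B) -
            (B * (H - (μc : ℂ) • Nt) - (H - (μc : ℂ) • Nt) * B) * B) *ᵥ χ)).re| ≤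
            (D + |μc| * DN) * (L' : ℝ) ^ 2 := by
      intro B D hBH hBN χ hχ
      have e : B * (B * (H - (μc : ℂ) • Nt) - (H - (μc : ℂ) • Nt) * B) -
          (B * (H - (μc : ℂ) • Nt) - (H - (μc : ℂ) • Nt) * B) * B =
          (B * (B * H - H * B) - (B * H - H * B) * B) -
            (μc : ℂ) • (B * (B * Nt - Nt * B) - (B * Nt - Nt * B) * B) := by
        simp only [Matrix.mul_sub, Matrix.sub_mul, Matrix.mul_smul, Matrix.smul_mul, smul_sub]
        abel
      rw [e, sub_mulVec, smul_mulVec, dotProduct_sub, dotProduct_smul, smul_eq_mul, Complex.sub_re,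
        Complex.re_ofReal_mul]
      have h1 := hBH χ hχ
      have h2 := mul_le_mul_of_nonneg_left (hBN χ hχ) (abs_nonneg μc)
      refine (abs_sub _ _).trans ?_
      rw [abs_mul]
      have e2 : (D + |μc| * DN) * (L' : ℝ) ^ 2 = D * (L' : ℝ) ^ 2 + |μc| * (DN * (L' : ℝ) ^ 2) := by ring
      rw [e2]
      exact add_le_add h1 h2
    have hDD₁K := hDDK B₁ hDD₁H (hDDN₁ L' hmL₁ hmN)
    have hDD₂K := hDDK B₂ hDD₂H (hDDN₂ L' hmL₁ hmN)
    have hcard : ⌊n * (((L' : ℕ)) : ℝ) ^ 2 / 2⌋₊ ≤ Fintype.card (FermionTorus 2 L') := by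
      rw [show Fintype.card (FermionTorus 2 L') = L' ^ 2 by simp]
      have h2 := rectN_le_two_mul hn0.le hn2.le L'
      simp only [rectN] at h2
      have e : L' ^ 2 = L' * L' := by ring
      rw [e]
      exact Nat.le_of_mul_le_mul_left h2 (by norm_num)
    have hE : H.minEnergyOn (szSector N 0) = groundEnergy H N := by
      simp only [hNdef, rectN]
      rw [groundEnergy_hubbardTorusTT'_eq_minEnergyOn_szSector L' t t' U hcard]
    set Efl : ℝ := (energyDensityTT' t t' U n - μc * n) * (L' : ℝ) ^ 2 - cc * L' - C₀ with hEfl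
    have hKfl : ∀ χ : Fock (Orb (FermionTorus 2 L')), star χ ⬝ᵥ χ = 1 →
        Efl ≤ (star χ ⬝ᵥ ((H - (μc : ℂ) • Nt) *ᵥ χ)).re := fun χ hχ =>
      sub_mul_sq_le_re_expect_sub_mul_totalNumber t t' hU hn0 hn2 hμc hL'1 χ hχ
    set ε : ℝ := max (groundEnergy H N + Dbar - μc * ((N : ℝ) + kt) - Efl) 0 with hεdef
    have hε : H.minEnergyOn (szSector N 0) + Dbar - μc * ((N : ℝ) + kt) - Efl ≤ ε := by
      rw [hE]; exact le_max_left _ _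
    have h := tower_finite_step_C g t t' U μc (hψ1 L') (hψ L') μ hκ hc₀ hCα hCκ hCγ kt
      (hα L' hmα) (hκ' L' hmκ) (hγ L' hmγ) hlro (hL₂ L' hm₂) _ B₁ B₂ hB₁h hB₂h hWB hD₁' hD₂'
      hDD₁K hDD₂K hKfl hε (hboundC L' hmL₁)
    rw [hE, ← hDbar, ← hK] at h
    have e1 : ((rectN n L' : ℕ) : ℝ) / 2 / (((L' : ℕ) : ℝ)) ^ 2 =
        ((rectN n L' : ℕ) : ℝ) / (((L' : ℕ) : ℝ)) ^ 2 / 2 := div_right_comm _ _ _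
    rw [e1] at h
    simp only [hlhs, hrhs, hLr, hNseq, hEseq, hSlseq, hεseq]
    rw [hm]
    exact h
  have h2k : Tendsto (fun k : ℕ => 2 * k) atTop atTop := Filter.tendsto_id.const_mul_atTop' (by norm_num)
  have hLr_top : Tendsto Lr atTop atTop := tendsto_natCast_atTop_atTop.comp h2k
  have hLr1 : Tendsto (fun k => (Lr k)⁻¹) atTop (𝓝 0) := hLr_top.inv_tendsto_atTop
  have hLr2 : Tendsto (fun k => (Lr k ^ 2)⁻¹) atTop (𝓝 0) :=
    ((tendsto_pow_atTop (α := ℝ) two_ne_zero).comp hLr_top).inv_tendsto_atTop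
  have hlhs_lim : Tendsto lhs atTop (𝓝 ((kt : ℝ) / (kt + 1) * Real.sqrt c₀)) := by
    have h1 : Tendsto (fun k => c₀ - (kt + 1) * Cγ * (Lr k ^ 2)⁻¹) atTop (𝓝 (c₀ - (kt + 1) * Cγ * 0)) :=
      tendsto_const_nhds.sub (hLr2.const_mul _)
    rw [mul_zero, sub_zero] at h1
    have h2 := (h1.sqrt).const_mul ((kt : ℝ) / (kt + 1))
    refine h2.congr' (Eventually.of_forall fun k => ?_)
    simp [hlhs, div_eq_mul_inv, mul_assoc]
  have hE_lim : Tendsto Eseq atTop (𝓝 (energyDensityTT' t t' U n)) :=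
    (tendsto_energyDensityTT'_torus t t' hU hn0.le hn2).comp h2k
  have hN_lim : Tendsto Nseq atTop (𝓝 n) := (tendsto_rectN_div_sq hn0.le).comp h2k
  have hd_lim : Tendsto dseq atTop (𝓝 0) := by
    have h1 : Tendsto (fun k => Eseq k + Dbar * (Lr k ^ 2)⁻¹ - μc * (Nseq k + kt * (Lr k ^ 2)⁻¹) -
        (energyDensityTT' t t' U n - μc * n) + cc * (Lr k)⁻¹ + C₀ * (Lr k ^ 2)⁻¹) atTop
        (𝓝 (energyDensityTT' t t' U n + Dbar * 0 - μc * (n + kt * 0) -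
          (energyDensityTT' t t' U n - μc * n) + cc * 0 + C₀ * 0)) :=
      ((((hE_lim.add (hLr2.const_mul Dbar)).sub ((hN_lim.add (hLr2.const_mul _)).const_mul μc)).sub
        tendsto_const_nhds).add (hLr1.const_mul cc)).add (hLr2.const_mul C₀)
    rw [show energyDensityTT' t t' U n + Dbar * 0 - μc * (n + kt * 0) -
        (energyDensityTT' t t' U n - μc * n) + cc * 0 + C₀ * 0 = 0 by ring] at h1
    refine h1.congr' (Eventually.of_forall fun k => ?_)
    simp [hdseq, div_eq_mul_inv]
  have hquot : ∀ k : ℕ, 1 ≤ k → εseq k / Lr k ^ 2 = max (dseq k) 0 := by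
    intro k hk
    have hLk : (0 : ℝ) < Lr k := by simp only [hLr]; positivity
    have hLk2 : (0 : ℝ) < Lr k ^ 2 := by positivity
    have hd : dseq k = (groundEnergy (hubbardTorusTT' (2 * k) t t' U) (rectN n (2 * k)) + Dbar -
        μc * ((rectN n (2 * k) : ℝ) + kt) -
        ((energyDensityTT' t t' U n - μc * n) * ((2 * k : ℕ) : ℝ) ^ 2 - cc * ((2 * k : ℕ) : ℝ) - C₀)) /
        Lr k ^ 2 := by
      simp only [hdseq, hEseq, hNseq, hLr]
      rw [hLr] at hLk
      field_simp
      ring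
    rw [hd, hεseq, ← max_div_div_right hLk2.le, zero_div]
  have hSl_eq : ∀ᶠ k : ℕ in atTop, Slseq k =
      Real.sqrt (2 * max (dseq k) 0 * D₁') + Real.sqrt (2 * max (dseq k) 0 * D₂') := by
    filter_upwards [Filter.eventually_ge_atTop 1] with k hk
    have hLk : (0 : ℝ) < Lr k := by simp only [hLr]; positivity
    have hε0 : 0 ≤ εseq k := by simp only [hεseq]; exact le_max_right _ _
    have key : ∀ D : ℝ, 0 ≤ D → Real.sqrt (2 * εseq k * D) / Lr k = Real.sqrt (2 * (εseq k / Lr k ^ 2) * D) := by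
      intro D hD
      rw [show 2 * (εseq k / Lr k ^ 2) * D = (2 * εseq k * D) / Lr k ^ 2 by ring,
        Real.sqrt_div (by positivity) (Lr k ^ 2), Real.sqrt_sq hLk.le]
    simp only [hSlseq]
    rw [add_div, key D₁' hD₁', key D₂' hD₂', hquot k hk]
  have hSl_lim : Tendsto Slseq atTop (𝓝 0) := by
    have hmax : Tendsto (fun k => max (dseq k) 0) atTop (𝓝 (max 0 0)) := hd_lim.max tendsto_const_nhds
    rw [max_self] at hmax
    have h1 : Tendsto (fun k => Real.sqrt (2 * max (dseq k) 0 * D₁')) atTop (𝓝 (Real.sqrt (2 * 0 * D₁'))) :=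
      ((hmax.const_mul 2).mul_const D₁').sqrt
    have h2 : Tendsto (fun k => Real.sqrt (2 * max (dseq k) 0 * D₂')) atTop (𝓝 (Real.sqrt (2 * 0 * D₂'))) :=
      ((hmax.const_mul 2).mul_const D₂').sqrt
    rw [mul_zero, zero_mul, Real.sqrt_zero] at h1 h2
    have h3 := h1.add h2
    rw [add_zero] at h3
    exact h3.congr' (hSl_eq.mono fun k hk => hk.symm)
  have hrhs_lim : Tendsto rhs atTop
      (𝓝 (-(c - A + (∑ σ : Fin 2, μ σ) * (n / 2 - ν) + κ * (u - energyDensityTT' t t' U n)) + K * 0 + 0)) := by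
    have h1 : Tendsto (fun k => -(c - A + (∑ σ : Fin 2, μ σ) * (Nseq k / 2 - ν) + κ * (u - Eseq k)))
        atTop (𝓝 (-(c - A + (∑ σ : Fin 2, μ σ) * (n / 2 - ν) + κ * (u - energyDensityTT' t t' U n)))) :=
      ((tendsto_const_nhds.add (((hN_lim.div_const 2).sub tendsto_const_nhds).const_mul _)).add
        ((tendsto_const_nhds.sub hE_lim).const_mul κ)).neg
    have h2 := (h1.add (hLr2.const_mul K)).add hSl_lim
    refine h2.congr' (Eventually.of_forall fun k => ?_)
    simp [hrhs, div_eq_mul_inv]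
  have hle := le_of_tendsto_of_tendsto hlhs_lim hrhs_lim hstep
  rw [mul_zero, add_zero, add_zero] at hle
  have hslack : 0 ≤ κ * (u - energyDensityTT' t t' U n) := mul_nonneg hκ (sub_nonneg.2 hu)
  have : (kt : ℝ) / (kt + 1) * Real.sqrt c₀ ≤ M := by linarith [hM, hle, hslack]
  linarith

end Family

end Summit.Ventures.CertifiedManyBodySolver.Observables

end
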